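import Mathlib
import HarnessLib
import Summits.FinalStateConjecture.FinalStateConjecture.Theorems.LogTimeThreeAnnuliDyadicCaptureDefs
import Literature.Geometry.Lorentzian.KerrCollarConvergence
import Literature.Geometry.Lorentzian.KerrConvergenceProofs
import Literature.Geometry.Lorentzian.KerrWaveEnergy
import Literature.Geometry.Lorentzian.KerrWaveDecay
import Literature.Geometry.Lorentzian.ApproximateKerrConfiguration

/-!
# Route LogTimeThreeAnnuli · crux `DyadicCapture`, line `registered` — restriction rechart, auxiliaries

Bookkeeping for the stub `stub_restrictionRechart` (6b) of the line `registered` of the crux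
`Summit.FinalStateConjecture.FinalStateConjecture.Theses.LogTimeThreeAnnuli.DyadicCapture`
(stmt-FinalStateConjecture-17488): restricting the reference hole charts `d.chart i` of a reference chart
system `d : QuasiFinalStateDecomposition 𝓢 O 2 ⊤` along the inclusion of the FROZEN exteriors
`boostedKerrExterior Λᵢ cᵢ (M i) (a i) ≤ boostedKerrExterior Λᵢ cᵢ (d.mass i) (d.spin i)`.

* the crude radius comparison `r_b ≤ r_a + |a|` between Kerr–Schild radii of different spins
  (`r_b ≤ |y̲|`, `|y̲|² − a² ≤ r_a²`; Visser arXiv:0706.0622, (35)), whence the comparison of truncated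
  slabs / world-tubes of two boosted Kerr backgrounds with the same motion;
* the truncated `Cᵏ` deviation of the restricted chart from the frozen boosted Kerr–Schild form is at most
  the deviation of the original chart from the same form on the enlarged reference slab
  (`Spacetime.supCkENorm_deviationExtend_comp_inclusion`, DHRT arXiv:2104.08222, §1), and the limits;
* the chain rule `d(Ψ ∘ ι)(x) w = dΨ(ι x) w` along the inclusion of open subsets of `E4`;
* re-basing a late-time chart to a later time and a smaller target region;
* the set identities: images of late regions / slabs / certified sets of the restricted charts are the
  `restrictedRegion / restrictedCharted / restrictedInitialSlabs / restrictedCertifiedLate /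
  restrictedCertifiedSlab` of `Theorems/LogTimeThreeAnnuliDyadicCaptureDefs.lean`.

All statements compare a structured object (a slab of a background, a projection) only with its explicit
normal form, never two backgrounds with different parameters (kernel-cheap definitional unfolding).
Sources: Dafermos–Luk arXiv:1710.01722, Conjecture 1 (b); DHRT arXiv:2104.08222, §1; Visser
arXiv:0706.0622, (35).
-/

-- the `Summit.FinalStateConjecture.FinalStateConjecture.…` namespace repeats the summit = sub-problem
-- segment (D-0017); deliberate.
set_option linter.dupNamespace false

noncomputable section

namespace Summit.FinalStateConjecture.FinalStateConjecture.Theorems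

open Literature.Geometry.Lorentzian
open scoped Topology Manifold ENNReal ContDiff
open Filter Set TopologicalSpace

/-! ### Radius and slab comparisons -/

/-- **Crude comparison of Kerr–Schild radii of different spins**: `r_b(y) ≤ r_a(y) + |a|`
(`r_b ≤ |y̲|` and `|y̲|² − a² ≤ r_a²`, Visser arXiv:0706.0622, (35)). [cite: arXiv07060622, (35)] -/
theorem restrictionRechart_radius_le_radius_add_abs (a b : ℝ) (y : E4) :
    Kerr.radius b y ≤ Kerr.radius a y + |a| := by
  have h1 := Kerr.radius_le_spatialNorm b y
  have h2 := Kerr.spatialNorm_sq_sub_sq_le_radius_sq a y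
  have hr := Kerr.radius_nonneg a y
  have hs := E4.spatialNorm_nonneg y
  have ha := abs_nonneg a
  have hsq : E4.spatialNorm y ^ 2 ≤ (Kerr.radius a y + |a|) ^ 2 := by nlinarith [sq_abs a]
  have h3 : E4.spatialNorm y ≤ Kerr.radius a y + |a| :=
    (pow_le_pow_iff_left₀ hs (by positivity) two_ne_zero).1 hsq
  exact h1.trans h3

/-- **World-tube comparison** along the inclusion of boosted Kerr exteriors with the same motion: the
image under `f ∘ ι` of `{t* > τ, r_{a₁} ≤ ρ}` lies in the image under `f` of `{t* > τ, r_{a₂} ≤ ρ'}` as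
soon as `ρ + |a₁| ≤ ρ'` (`restrictionRechart_radius_le_radius_add_abs`). [folklore] -/
theorem restrictionRechart_image_truncLateRegion_subset (Λ : lorentzGroup) (c : E4)
    (M₁ a₁ M₂ a₂ : ℝ) (h : boostedKerrExterior Λ c M₁ a₁ ≤ boostedKerrExterior Λ c M₂ a₂)
    {X : Type*} (f : boostedKerrExterior Λ c M₂ a₂ → X) {τ ρ ρ' : ℝ} (hρ : ρ + |a₁| ≤ ρ') :
    (f ∘ Opens.inclusion h) '' (boostedKerrBackground Λ c M₁ a₁).truncLateRegion τ ρ ⊆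
      f '' (boostedKerrBackground Λ c M₂ a₂).truncLateRegion τ ρ' := by
  rintro _ ⟨x, hx, rfl⟩
  obtain ⟨hx₁, hx₂⟩ := hx
  have h1 := restrictionRechart_radius_le_radius_add_abs a₁ a₂ (poincareInv Λ c x.1)
  have h2 : Kerr.radius a₁ (poincareInv Λ c x.1) ≤ ρ := hx₂
  have h3 : τ < poincareInv Λ c x.1 0 := hx₁
  have h4 : Kerr.radius a₂ (poincareInv Λ c x.1) ≤ ρ' := by linarith
  exact ⟨Opens.inclusion h x, ⟨h3, h4⟩, rfl⟩

/-! ### The deviation of the restricted chart -/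

section Deviation

variable {𝓢 : Spacetime.{0} 4} {B : ModelBackground} {Ψ : B.domain → 𝓢.carrier} {k : ℕ}

/-- Truncated convergence passes to smaller (time-dependent) truncation radii
(`truncDeviationCk_mono`). [folklore] -/
theorem restrictionRechart_tendsto_truncDeviationCk_of_le {R R' : ℝ → ℝ} (hle : ∀ τ, R' τ ≤ R τ)
    (h : Tendsto (fun τ ↦ 𝓢.truncDeviationCk B Ψ k (R τ) τ) atTop (𝓝 0)) :
    Tendsto (fun τ ↦ 𝓢.truncDeviationCk B Ψ k (R' τ) τ) atTop (𝓝 0) :=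
  tendsto_of_tendsto_of_tendsto_of_le_of_le tendsto_const_nhds h (fun _ ↦ zero_le)
    fun τ ↦ 𝓢.truncDeviationCk_mono B Ψ k (hle τ) τ

/-- Truncated convergence out to `R(τ)` and out to `ρ₀` give truncated convergence out to
`max (R τ) ρ₀` (the slab is one of the two). [folklore] -/
theorem restrictionRechart_tendsto_truncDeviationCk_max {R : ℝ → ℝ} {ρ₀ : ℝ}
    (h₁ : Tendsto (fun τ ↦ 𝓢.truncDeviationCk B Ψ k (R τ) τ) atTop (𝓝 0))
    (h₂ : Tendsto (fun τ ↦ 𝓢.truncDeviationCk B Ψ k ρ₀ τ) atTop (𝓝 0)) :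
    Tendsto (fun τ ↦ 𝓢.truncDeviationCk B Ψ k (max (R τ) ρ₀) τ) atTop (𝓝 0) := by
  have hsum : Tendsto (fun τ ↦ 𝓢.truncDeviationCk B Ψ k (R τ) τ + 𝓢.truncDeviationCk B Ψ k ρ₀ τ)
      atTop (𝓝 0) := by
    simpa using h₁.add h₂
  refine tendsto_of_tendsto_of_tendsto_of_le_of_le tendsto_const_nhds hsum (fun _ ↦ zero_le)
    fun τ ↦ ?_
  rcases le_total (R τ) ρ₀ with hle | hle
  · have e : max (R τ) ρ₀ = ρ₀ := max_eq_right hle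
    rw [e]
    exact le_add_self
  · have e : max (R τ) ρ₀ = R τ := max_eq_left hle
    rw [e]
    exact le_self_add

/-- **Truncated convergence passes to the restricted chart.** Let `B` be a background whose domain
contains the frozen exterior `boostedKerrExterior Λ c M₁ a₁`, whose reference form is the frozen
boosted Kerr–Schild form `g_{M₁,a₁,Λ,c}`, with rest-frame time `(Λ⁻¹(x − c))⁰` and rest-frame radius
`r_{a₂}(Λ⁻¹(x − c))`, and let `Ψ` be a smooth chart on `B.domain`. If the truncated `Cᵏ` deviation of `Ψ`
from `B` out to radius `r(τ) + |a₁| + |a₂|` tends to `0`, then so does the truncated `Cᵏ` deviation of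
`Ψ ∘ ι` from the frozen boosted Kerr background out to radius `r(τ)`: on the smaller (open) domain the
extended deviations agree (`Spacetime.supCkENorm_deviationExtend_comp_inclusion`), and
`{r_{a₁} ≤ r(τ)} ⊆ {r_{a₂} ≤ r(τ) + |a₁| + |a₂|}`. DHRT arXiv:2104.08222, §1. [cite: arXiv210408222, §1] -/
theorem restrictionRechart_tendsto_truncDeviationCk_comp_inclusion (Λ : lorentzGroup) (c : E4)
    (M₁ a₁ a₂ : ℝ) {r : ℝ → ℝ}
    (hlim : Tendsto (fun τ ↦ 𝓢.truncDeviationCk B Ψ k (r τ + |a₁| + |a₂|) τ) atTop (𝓝 0))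
    (hΨ : ContMDiff 𝓘(ℝ, E4) (𝓡 4) ∞ Ψ) (h : boostedKerrExterior Λ c M₁ a₁ ≤ B.domain)
    (hb : ∀ x : E4, B.bilin x = boostedKerrBilin Λ c M₁ a₁ x)
    (ht : ∀ x : E4, B.time x = poincareInv Λ c x 0)
    (hr : ∀ x : E4, B.radius x = Kerr.radius a₂ (poincareInv Λ c x)) :
    Tendsto (fun τ ↦ 𝓢.truncDeviationCk (boostedKerrBackground Λ c M₁ a₁) (Ψ ∘ Opens.inclusion h)
      k (r τ) τ) atTop (𝓝 0) := by
  have hb' : ∀ x : (boostedKerrBackground Λ c M₁ a₁).domain,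
      (boostedKerrBackground Λ c M₁ a₁).bilin x.1 = B.bilin x.1 := fun x ↦ (hb x.1).symm
  have heq : ∀ τ, 𝓢.truncDeviationCk (boostedKerrBackground Λ c M₁ a₁) (Ψ ∘ Opens.inclusion h)
      k (r τ) τ ≤ 𝓢.truncDeviationCk B Ψ k (r τ + |a₁| + |a₂|) τ := by
    intro τ
    have hS : Subtype.val '' (boostedKerrBackground Λ c M₁ a₁).truncTimeSlab (r τ) τ ⊆
        ((boostedKerrBackground Λ c M₁ a₁).domain : Set E4) := by
      rintro _ ⟨x, -, rfl⟩
      exact x.2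
    have hsub : Subtype.val '' (boostedKerrBackground Λ c M₁ a₁).truncTimeSlab (r τ) τ ⊆
        Subtype.val '' B.truncTimeSlab (r τ + |a₁| + |a₂|) τ := by
      rintro _ ⟨x, hx, rfl⟩
      rw [ModelBackground.mem_truncTimeSlab] at hx
      refine ⟨Opens.inclusion h x, ?_, rfl⟩
      rw [ModelBackground.mem_truncTimeSlab, ht, hr]
      have h1 := restrictionRechart_radius_le_radius_add_abs a₁ a₂ (poincareInv Λ c x.1)
      have h2 : poincareInv Λ c x.1 0 = τ := hx.1
      have h3 : Kerr.radius a₁ (poincareInv Λ c x.1) ≤ r τ := hx.2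
      have h4 := abs_nonneg a₂
      refine ⟨h2, ?_⟩
      show Kerr.radius a₂ (poincareInv Λ c x.1) ≤ r τ + |a₁| + |a₂|
      linarith
    rw [Spacetime.truncDeviationCk, Spacetime.truncDeviationCk,
      𝓢.supCkENorm_deviationExtend_comp_inclusion h hb' hΨ hS k]
    exact supCkENorm_mono hsub _ _
  exact tendsto_of_tendsto_of_tendsto_of_le_of_le tendsto_const_nhds hlim (fun _ ↦ zero_le) heq

end Deviation

/-! ### The differential of the restricted chart -/

/-- **Chain rule along the inclusion of open subsets of `E4`, applied to a vector**:
`d(Ψ ∘ ι)(x) w = dΨ(ι x) w` (the inclusion has identity differential,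
`OpensChart.mfderiv_inclusion_apply`; Lee 2013, Prop. 3.9). [folklore] -/
-- adapted from the private `mfderiv_comp_opensInclusion` of `Literature/Geometry/Lorentzian/KerrCollarConvergence.lean`
theorem restrictionRechart_mfderiv_comp_inclusion_apply {U V : Opens E4} (h : U ≤ V) {N : Type*}
    [TopologicalSpace N] [ChartedSpace E4 N] {Ψ : V → N} (x : U)
    (hΨ : MDifferentiableAt 𝓘(ℝ, E4) (𝓡 4) Ψ (Opens.inclusion h x)) (w : E4) :
    mfderiv 𝓘(ℝ, E4) (𝓡 4) (Ψ ∘ Opens.inclusion h) x w =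
      mfderiv 𝓘(ℝ, E4) (𝓡 4) Ψ (Opens.inclusion h x) w := by
  rw [mfderiv_comp x hΨ ((contMDiff_inclusion (n := ∞) h x).mdifferentiableAt (by simp))]
  show mfderiv 𝓘(ℝ, E4) (𝓡 4) Ψ (Opens.inclusion h x)
      (mfderiv 𝓘(ℝ, E4) 𝓘(ℝ, E4) (Opens.inclusion h) x w) = _
  rw [OpensChart.mfderiv_inclusion_apply h x w]

/-! ### Re-basing a late-time chart -/

/-- **A late-time chart stays a late-time chart after a later initial time and for any target region
containing the new late image**: smoothness is untouched, and the late region `{t > τ₁} ⊆ {t > τ₀}` is an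
open subset (continuity of `t`), so the open-embedding property restricts (DHRT arXiv:2104.08222, §1).
[folklore] -/
theorem restrictionRechart_isLateChart_of_le {𝓢 : Spacetime.{0} 4} {B : ModelBackground}
    {O O' : Set 𝓢.carrier} {τ₀ τ₁ : ℝ} {Ψ : B.domain → 𝓢.carrier} (hΨ : 𝓢.IsLateChart B O τ₀ Ψ)
    (hc : Continuous B.time) (hτ : τ₀ ≤ τ₁) (himg : Ψ '' B.lateRegion τ₁ ⊆ O') :
    𝓢.IsLateChart B O' τ₁ Ψ where
  contMDiff := hΨ.contMDiff
  isOpenEmbedding := by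
    have hopen : ∀ τ : ℝ, IsOpen (B.lateRegion τ) := fun τ ↦
      isOpen_lt continuous_const (hc.comp continuous_subtype_val)
    let j : B.lateRegion τ₁ → B.lateRegion τ₀ := Set.inclusion (B.lateRegion_mono hτ)
    have h₀ : Topology.IsOpenEmbedding (Subtype.val : B.lateRegion τ₀ → B.domain) :=
      (hopen τ₀).isOpenEmbedding_subtypeVal
    have h₁ : Topology.IsOpenEmbedding (Subtype.val : B.lateRegion τ₁ → B.domain) :=
      (hopen τ₁).isOpenEmbedding_subtypeVal
    have hj : Topology.IsOpenEmbedding j := Topology.IsOpenEmbedding.of_comp j h₀ h₁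
    exact hΨ.isOpenEmbedding.comp hj
  image_subset := himg

/-! ### Set identities for the restricted charts -/

section Restricted

variable {𝓢 : Spacetime.{0} 4} {O : Set 𝓢.carrier} (d : QuasiFinalStateDecomposition 𝓢 O 2 ⊤)
  (M a : Fin d.N → ℝ)

/-- The late image of the restricted chart of hole `i` after `τ₁` is the restricted hole region
`restrictedRegion … τ₁ i` (image of the inclusion `{t* > τ₁} ↦ {t* > τ₁, r_{aᵢ} > r₊(Mᵢ,aᵢ)}`, then
`Set.image_comp`). [folklore] -/
theorem restrictionRechart_image_lateRegion (i : Fin d.N)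
    (h : boostedKerrExterior (d.motion i).1 (d.motion i).2 (M i) (a i) ≤
      boostedKerrExterior (d.motion i).1 (d.motion i).2 (d.mass i) (d.spin i)) (τ₁ : ℝ) :
    (d.chart i ∘ Opens.inclusion h) ''
        (boostedKerrBackground (d.motion i).1 (d.motion i).2 (M i) (a i)).lateRegion τ₁ =
      restrictedRegion 𝓢 O d M a τ₁ i := by
  rw [restrictedRegion_eq, Set.image_comp]
  congr 1
  ext x
  simp only [Set.mem_image, Set.mem_setOf_eq]
  constructor
  · rintro ⟨y, hy, rfl⟩
    exact ⟨hy, mem_boostedKerrExterior.1 y.2⟩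
  · rintro ⟨ht, hm⟩
    exact ⟨⟨x.1, mem_boostedKerrExterior.2 hm⟩, ht, rfl⟩

/-- The image of the initial slab `{t* = τ₁}` of the restricted chart of hole `i` is the reference
chart's image of `{t*ᵢ = τ₁, r_{aᵢ} > r₊(Mᵢ,aᵢ)}`. [folklore] -/
theorem restrictionRechart_image_timeSlab (i : Fin d.N)
    (h : boostedKerrExterior (d.motion i).1 (d.motion i).2 (M i) (a i) ≤
      boostedKerrExterior (d.motion i).1 (d.motion i).2 (d.mass i) (d.spin i)) (τ₁ : ℝ) :
    (d.chart i ∘ Opens.inclusion h) ''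
        (boostedKerrBackground (d.motion i).1 (d.motion i).2 (M i) (a i)).timeSlab τ₁ =
      d.chart i '' {x | (d.background i).time x.1 = τ₁ ∧
        poincareInv (d.motion i).1 (d.motion i).2 x.1 ∈ Kerr.exterior (M i) (a i)} := by
  rw [Set.image_comp]
  congr 1
  ext x
  simp only [Set.mem_image, Set.mem_setOf_eq]
  constructor
  · rintro ⟨y, hy, rfl⟩
    exact ⟨hy, mem_boostedKerrExterior.1 y.2⟩
  · rintro ⟨ht, hm⟩
    exact ⟨⟨x.1, mem_boostedKerrExterior.2 hm⟩, ht, rfl⟩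

/-- The image of the growing near zone `{t* > τ₂, r_{aᵢ} ≤ R'(t*)}` of the restricted chart of hole `i`
is the reference chart's image of `{t*ᵢ > τ₂, r_{aᵢ} > r₊(Mᵢ,aᵢ), r_{aᵢ} ≤ R'(t*ᵢ)}`. [folklore] -/
theorem restrictionRechart_image_certifiedLate (i : Fin d.N)
    (h : boostedKerrExterior (d.motion i).1 (d.motion i).2 (M i) (a i) ≤
      boostedKerrExterior (d.motion i).1 (d.motion i).2 (d.mass i) (d.spin i))
    (R' : ℝ → ℝ) (τ₂ : ℝ) :
    (d.chart i ∘ Opens.inclusion h) ''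
        {x | τ₂ < (boostedKerrBackground (d.motion i).1 (d.motion i).2 (M i) (a i)).time x.1 ∧
          (boostedKerrBackground (d.motion i).1 (d.motion i).2 (M i) (a i)).radius x.1 ≤
            R' ((boostedKerrBackground (d.motion i).1 (d.motion i).2 (M i) (a i)).time x.1)} =
      d.chart i '' {x | τ₂ < (d.background i).time x.1 ∧
        poincareInv (d.motion i).1 (d.motion i).2 x.1 ∈ Kerr.exterior (M i) (a i) ∧
        Kerr.radius (a i) (poincareInv (d.motion i).1 (d.motion i).2 x.1) ≤
          R' ((d.background i).time x.1)} := by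
  rw [Set.image_comp]
  congr 1
  ext x
  simp only [Set.mem_image, Set.mem_setOf_eq]
  constructor
  · rintro ⟨y, ⟨hy₁, hy₂⟩, rfl⟩
    exact ⟨hy₁, mem_boostedKerrExterior.1 y.2, hy₂⟩
  · rintro ⟨ht, hm, hr⟩
    exact ⟨⟨x.1, mem_boostedKerrExterior.2 hm⟩, ⟨ht, hr⟩, rfl⟩

/-- The image of the truncated slab `{t* = τ₂, r_{aᵢ} ≤ ρ}` of the restricted chart of hole `i` is the
reference chart's image of `{t*ᵢ = τ₂, r_{aᵢ} > r₊(Mᵢ,aᵢ), r_{aᵢ} ≤ ρ}`. [folklore] -/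
theorem restrictionRechart_image_certifiedSlab (i : Fin d.N)
    (h : boostedKerrExterior (d.motion i).1 (d.motion i).2 (M i) (a i) ≤
      boostedKerrExterior (d.motion i).1 (d.motion i).2 (d.mass i) (d.spin i)) (ρ τ₂ : ℝ) :
    (d.chart i ∘ Opens.inclusion h) ''
        (boostedKerrBackground (d.motion i).1 (d.motion i).2 (M i) (a i)).truncTimeSlab ρ τ₂ =
      d.chart i '' {x | (d.background i).time x.1 = τ₂ ∧
        poincareInv (d.motion i).1 (d.motion i).2 x.1 ∈ Kerr.exterior (M i) (a i) ∧
        Kerr.radius (a i) (poincareInv (d.motion i).1 (d.motion i).2 x.1) ≤ ρ} := by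
  rw [Set.image_comp]
  congr 1
  ext x
  simp only [Set.mem_image, Set.mem_setOf_eq]
  constructor
  · rintro ⟨y, ⟨hy₁, hy₂⟩, rfl⟩
    exact ⟨hy₁, mem_boostedKerrExterior.1 y.2, hy₂⟩
  · rintro ⟨ht, hm, hr⟩
    exact ⟨⟨x.1, mem_boostedKerrExterior.2 hm⟩, ⟨ht, hr⟩, rfl⟩

variable (h : ∀ i : Fin d.N, boostedKerrExterior (d.motion i).1 (d.motion i).2 (M i) (a i) ≤
  boostedKerrExterior (d.motion i).1 (d.motion i).2 (d.mass i) (d.spin i))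

/-- **The charted set of the restricted system is `restrictedCharted`**: flat late image plus the late
images of the restricted hole charts after `τ₁`. [folklore] -/
theorem restrictionRechart_charted_eq (τ₁ : ℝ) :
    d.flatChart '' (Minkowski.backgroundOn d.flatDomain).lateRegion τ₁ ∪
        ⋃ i, (d.chart i ∘ Opens.inclusion (h i)) ''
          (boostedKerrBackground (d.motion i).1 (d.motion i).2 (M i) (a i)).lateRegion τ₁ =
      restrictedCharted 𝓢 O d M a τ₁ := by
  rw [restrictedCharted_eq, iUnion_congr fun i ↦ restrictionRechart_image_lateRegion d M a i (h i) τ₁]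

/-- **The initial slabs of the restricted system are `restrictedInitialSlabs`.** [folklore] -/
theorem restrictionRechart_initialSlabs_eq (τ₁ : ℝ) :
    d.flatChart '' (Minkowski.backgroundOn d.flatDomain).timeSlab τ₁ ∪
        ⋃ i, (d.chart i ∘ Opens.inclusion (h i)) ''
          (boostedKerrBackground (d.motion i).1 (d.motion i).2 (M i) (a i)).timeSlab τ₁ =
      restrictedInitialSlabs 𝓢 O d M a τ₁ := by
  rw [restrictedInitialSlabs_eq,
    iUnion_congr fun i ↦ restrictionRechart_image_timeSlab d M a i (h i) τ₁]

/-- **The certified late region of the restricted system is `restrictedCertifiedLate`.** [folklore] -/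
theorem restrictionRechart_certifiedLate_eq (R' : Fin d.N → ℝ → ℝ) (τ₂ : ℝ) :
    d.flatChart '' (Minkowski.backgroundOn d.flatDomain).lateRegion τ₂ ∪
        ⋃ i, (d.chart i ∘ Opens.inclusion (h i)) ''
          {x | τ₂ < (boostedKerrBackground (d.motion i).1 (d.motion i).2 (M i) (a i)).time x.1 ∧
            (boostedKerrBackground (d.motion i).1 (d.motion i).2 (M i) (a i)).radius x.1 ≤
              R' i ((boostedKerrBackground (d.motion i).1 (d.motion i).2 (M i) (a i)).time x.1)} =
      restrictedCertifiedLate 𝓢 O d M a R' τ₂ := by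
  rw [restrictedCertifiedLate_eq,
    iUnion_congr fun i ↦ restrictionRechart_image_certifiedLate d M a i (h i) (R' i) τ₂]

/-- **The certified slab of the restricted system is `restrictedCertifiedSlab`.** [folklore] -/
theorem restrictionRechart_certifiedSlab_eq (R' : Fin d.N → ℝ → ℝ) (τ₂ : ℝ) :
    d.flatChart '' (Minkowski.backgroundOn d.flatDomain).timeSlab τ₂ ∪
        ⋃ i, (d.chart i ∘ Opens.inclusion (h i)) ''
          (boostedKerrBackground (d.motion i).1 (d.motion i).2 (M i) (a i)).truncTimeSlab
            (R' i τ₂) τ₂ =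
      restrictedCertifiedSlab 𝓢 O d M a R' τ₂ := by
  rw [restrictedCertifiedSlab_eq,
    iUnion_congr fun i ↦ restrictionRechart_image_certifiedSlab d M a i (h i) (R' i τ₂) τ₂]

end Restricted

/-! ### Registered helper (so that this auxiliary file can be attached to the crux item) -/

/-- **Crude comparison of Kerr–Schild radii of different spins** (`restrictionRechartAux_radius_le`,
the name under which this auxiliary file is attached to the crux item stmt-FinalStateConjecture-17488):
`r_b(y) ≤ r_a(y) + |a|` (Visser arXiv:0706.0622, (35)). [cite: arXiv07060622, (35)] -/
theorem restrictionRechartAux_radius_le : ∀ (a b : ℝ) (y : E4), Kerr.radius b y ≤ Kerr.radius a y + |a| :=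
  restrictionRechart_radius_le_radius_add_abs

end Summit.FinalStateConjecture.FinalStateConjecture.Theorems

end
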